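import Summits.AtomisticToContinuum.HydrodynamicLimit.Theorems.EnskogAdjointDualityAdjointEnskogTestFamilyRSphereCalculus
import Literature.Analysis.FunctionSpaces.PeriodicLogCost
import HarnessLib

/-!
# K2R refutation, stub `transportKappaZero`: identity (0), transport of the corrector

Route `EnskogAdjointDuality` of `AtomisticToContinuum/HydrodynamicLimit`, crux K2R
`AdjointEnskogTestFamilyR` (stmt-AtomisticToContinuum-11592), line `refutation`, registered stub
`stub_transportKappaZero`.

Testing the defect inequality against `Z(s, x) Θ₀^R(v)` with `Z = ζ(s) cos(2πx₀)` and the critical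
weight `Θ₀^R(v) = (1 + |v|²)⁻³ e^{-|v|²/R}` produces, on the corrector part `λ⁻¹ κ` of the test
function, the transport coefficient `A₀ = -(z' cos(2πx₀) + z v₀ (-2π sin(2πx₀)))` (`z = ζ(s)`,
`z' = ζ'(s)`).  Pointwise
`Θ₀ A₀ λ⁻¹κ = -(z'/λ) Θ₀ cos(2πx₀) κ + z (2π/λ) Θ₀ v₀ sin(2πx₀) κ`;
the second term integrates to `z (2π/λ) 𝔨₀` with the first-moment functional
`𝔨₀ = ∫∫ Θ₀ v₀ sin(2πx₀) κ`, and the first is bounded by `λ⁻¹ |z'| C (m₀ + m₂) ≤ 40 C |z'| / λ`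
(`|κ| ≤ C(1 + |v|²)`, `|cos| ≤ 1`, the torus has mass one, and the moments `m₀, m₂ ≤ 20` of
`Θ₀^R` from `k2r_ref_R3_facts`).  Integrability on `𝕋³ × ℝ³` is by domination with an integrable
function of the velocity alone (`k2r_ref_tk_integrable_prod`). [folklore]
-/

noncomputable section

open MeasureTheory Set Filter Function
open scoped InnerProductSpace Real

namespace Summit.AtomisticToContinuum.HydrodynamicLimit.Theorems.EnskogAdjointDuality

open Literature.MathematicalPhysics.KineticTheory Literature.Analysis.FluidPDE Literature.Analysis.FunctionSpaces

/-! ## Product-measure plumbing on `𝕋³ × ℝ³` -/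

/-- Domination on `𝕋³ × ℝ³` by an integrable function of the velocity alone: a continuous `F` with
`|F(x, v)| ≤ g(v)`, `g ∈ L¹(ℝ³)`, is integrable for `volume.prod volume` (the torus carries a
probability measure). [folklore] -/
theorem k2r_ref_tk_integrable_prod {F : UnitAddTorus (Fin 3) × EuclideanSpace ℝ (Fin 3) → ℝ}
    (hF : Continuous F) {g : EuclideanSpace ℝ (Fin 3) → ℝ} (hg : Integrable g)
    (h : ∀ p : UnitAddTorus (Fin 3) × EuclideanSpace ℝ (Fin 3), |F p| ≤ g p.2) :
    Integrable F ((volume : Measure (UnitAddTorus (Fin 3))).prod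
      (volume : Measure (EuclideanSpace ℝ (Fin 3)))) :=
  (hg.comp_snd volume).mono' hF.aestronglyMeasurable
    (Eventually.of_forall fun p => by rw [Real.norm_eq_abs]; exact h p)

/-- With the same domination, `|∫ F d(x, v)| ≤ ∫ g dv` (torus mass one). [folklore] -/
theorem k2r_ref_tk_abs_integral_prod_le {F : UnitAddTorus (Fin 3) × EuclideanSpace ℝ (Fin 3) → ℝ}
    {g : EuclideanSpace ℝ (Fin 3) → ℝ} (hg : Integrable g)
    (h : ∀ p : UnitAddTorus (Fin 3) × EuclideanSpace ℝ (Fin 3), |F p| ≤ g p.2) :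
    |∫ p, F p ∂((volume : Measure (UnitAddTorus (Fin 3))).prod
      (volume : Measure (EuclideanSpace ℝ (Fin 3))))| ≤ ∫ v, g v := by
  have := norm_integral_le_of_norm_le (hg.comp_snd volume)
    (Eventually.of_forall fun p => by rw [Real.norm_eq_abs]; exact h p)
  rwa [integral_fun_snd, probReal_univ, one_smul, Real.norm_eq_abs] at this

/-- `|sin(2π x_i)| ≤ 1` on the torus. [folklore] -/
theorem k2r_ref_tk_abs_sinCoord_le (i : Fin 3) (x : UnitAddTorus (Fin 3)) :
    |Torus.sinCoord i x| ≤ 1 := by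
  obtain ⟨t, ht⟩ := Torus.exists_coe_eq (x i)
  rw [Torus.sinCoord_of_eq ht.symm]
  exact Real.abs_sin_le_one _

/-! ## The registered stub -/

/-- **Stub `stub_transportKappaZero` of the K2R refutation line** (identity (0), transport of `κ`):
against the critical weight `Θ₀^R(v) = (1+|v|²)⁻³e^{-|v|²/R}` and the coefficient
`-(z' cos(2πx₀) + z v₀ (-2π sin(2πx₀)))`, the corrector part `λ⁻¹κ` gives `z (2π/λ) 𝔨₀`,
`𝔨₀ = ∫∫ Θ₀ v₀ sin(2πx₀) κ`, up to `(|z| + |z'|) · 40 C/λ`; the integrand is integrable on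
`𝕋³ × ℝ³`. [folklore] -/
theorem stub_transportKappaZero :
  ∀ (Y₀ ρ₀ ε lam C : ℝ), 0 < Y₀ → 0 < ρ₀ → 0 < ε → 2 * Real.pi * ε ≤ Real.pi / 2 → 0 < lam → 0 ≤ C →
  ∃ Bdd : ℝ, ∀ (cc : UnitAddTorus (Fin 3) → ℝ × EuclideanSpace ℝ (Fin 3) × ℝ) (κ : UnitAddTorus (Fin 3) → EuclideanSpace ℝ (Fin 3) → ℝ),
    Continuous cc → Continuous (Function.uncurry κ) → (∀ x, ‖cc x‖ ≤ C) →
    (∀ x y, dist (cc x) (cc y) ≤ C * dist x y) → (∀ x v, |κ x v| ≤ C * (1 + ‖v‖ ^ 2)) →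
    ∀ R : ℝ, 1 ≤ R → ∀ z z' : ℝ,
    Integrable (fun p : UnitAddTorus (Fin 3) × EuclideanSpace ℝ (Fin 3) => ((1 + ‖p.2‖ ^ 2) ^ 3)⁻¹ * Real.exp (-‖p.2‖ ^ 2 / R) * ((-(z' * Torus.cosCoord 0 p.1 + z * (p.2 0 * (-(2 * Real.pi) * Torus.sinCoord 0 p.1)))) * (lam⁻¹ * κ p.1 p.2))) (volume.prod volume) ∧
    |(∫ x : UnitAddTorus (Fin 3), ∫ v : EuclideanSpace ℝ (Fin 3), ((1 + ‖v‖ ^ 2) ^ 3)⁻¹ * Real.exp (-‖v‖ ^ 2 / R) * ((-(z' * Torus.cosCoord 0 x + z * (v 0 * (-(2 * Real.pi) * Torus.sinCoord 0 x)))) * (lam⁻¹ * κ x v))) -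
        z * (2 * Real.pi / lam) * (∫ x : UnitAddTorus (Fin 3), ∫ v : EuclideanSpace ℝ (Fin 3), ((1 + ‖v‖ ^ 2) ^ 3)⁻¹ * Real.exp (-‖v‖ ^ 2 / R) * v 0 * Torus.sinCoord 0 x * κ x v)| ≤ (|z| + |z'|) * Bdd := by
  intro Y₀ ρ₀ ε lam C _ _ _ _ hlam hC
  refine ⟨40 * C / lam, fun cc κ _ hκ _ _ hκb R hR z z' => ?_⟩
  -- moments of the critical weight
  obtain ⟨hm, -, hm3, -⟩ := k2r_ref_R3_facts hR
  obtain ⟨hi0, hI0⟩ := hm 0 (by norm_num)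
  obtain ⟨hi1, -⟩ := hm 1 (by norm_num)
  obtain ⟨hi2, hI2⟩ := hm 2 (by norm_num)
  obtain ⟨hi3, -⟩ := hm3
  have hκc : Continuous fun p : UnitAddTorus (Fin 3) × EuclideanSpace ℝ (Fin 3) => κ p.1 p.2 := hκ
  have hcos : Continuous fun x : UnitAddTorus (Fin 3) => Torus.cosCoord 0 x :=
    (Torus.isSmooth_cosCoord 0).continuous
  have hsin : Continuous fun x : UnitAddTorus (Fin 3) => Torus.sinCoord 0 x :=
    (Torus.isSmooth_sinCoord 0).continuous
  have hv0 : ∀ v : EuclideanSpace ℝ (Fin 3), |v 0| ≤ ‖v‖ := fun v => by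
    simpa using PiLp.norm_apply_le v 0
  have hth : ∀ v : EuclideanSpace ℝ (Fin 3), 0 ≤ ((1 + ‖v‖ ^ 2) ^ 3)⁻¹ * Real.exp (-‖v‖ ^ 2 / R) :=
    fun v => by positivity
  -- the `z'`-piece `Θ₀ cos(2πx₀) κ`
  have hG1b : ∀ p : UnitAddTorus (Fin 3) × EuclideanSpace ℝ (Fin 3),
      |((1 + ‖p.2‖ ^ 2) ^ 3)⁻¹ * Real.exp (-‖p.2‖ ^ 2 / R) * Torus.cosCoord 0 p.1 * κ p.1 p.2| ≤
        C * (‖p.2‖ ^ 0 * (((1 + ‖p.2‖ ^ 2) ^ 3)⁻¹ * Real.exp (-‖p.2‖ ^ 2 / R)) +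
          ‖p.2‖ ^ 2 * (((1 + ‖p.2‖ ^ 2) ^ 3)⁻¹ * Real.exp (-‖p.2‖ ^ 2 / R))) := by
    rintro ⟨x, v⟩
    dsimp only
    rw [abs_mul, abs_mul, abs_of_nonneg (hth v)]
    calc ((1 + ‖v‖ ^ 2) ^ 3)⁻¹ * Real.exp (-‖v‖ ^ 2 / R) * |Torus.cosCoord 0 x| * |κ x v|
        ≤ ((1 + ‖v‖ ^ 2) ^ 3)⁻¹ * Real.exp (-‖v‖ ^ 2 / R) * 1 * (C * (1 + ‖v‖ ^ 2)) := by
          gcongr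
          · exact Torus.abs_cosCoord_le 0 x
          · exact hκb x v
      _ = _ := by ring
  have hg1 : Integrable (fun v : EuclideanSpace ℝ (Fin 3) =>
      C * (‖v‖ ^ 0 * (((1 + ‖v‖ ^ 2) ^ 3)⁻¹ * Real.exp (-‖v‖ ^ 2 / R)) +
        ‖v‖ ^ 2 * (((1 + ‖v‖ ^ 2) ^ 3)⁻¹ * Real.exp (-‖v‖ ^ 2 / R)))) :=
    (hi0.fun_add hi2).const_mul C
  have hG1 : Integrable (fun p : UnitAddTorus (Fin 3) × EuclideanSpace ℝ (Fin 3) =>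
      ((1 + ‖p.2‖ ^ 2) ^ 3)⁻¹ * Real.exp (-‖p.2‖ ^ 2 / R) * Torus.cosCoord 0 p.1 * κ p.1 p.2)
      (volume.prod volume) :=
    k2r_ref_tk_integrable_prod (by fun_prop (disch := intros; positivity)) hg1 hG1b
  -- the `z`-piece `Θ₀ v₀ sin(2πx₀) κ`
  have hG2b : ∀ p : UnitAddTorus (Fin 3) × EuclideanSpace ℝ (Fin 3),
      |((1 + ‖p.2‖ ^ 2) ^ 3)⁻¹ * Real.exp (-‖p.2‖ ^ 2 / R) * p.2 0 * Torus.sinCoord 0 p.1 * κ p.1 p.2| ≤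
        C * (‖p.2‖ ^ 1 * (((1 + ‖p.2‖ ^ 2) ^ 3)⁻¹ * Real.exp (-‖p.2‖ ^ 2 / R)) +
          ‖p.2‖ ^ 3 * (((1 + ‖p.2‖ ^ 2) ^ 3)⁻¹ * Real.exp (-‖p.2‖ ^ 2 / R))) := by
    rintro ⟨x, v⟩
    dsimp only
    rw [abs_mul, abs_mul, abs_mul, abs_of_nonneg (hth v)]
    calc ((1 + ‖v‖ ^ 2) ^ 3)⁻¹ * Real.exp (-‖v‖ ^ 2 / R) * |v 0| * |Torus.sinCoord 0 x| * |κ x v|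
        ≤ ((1 + ‖v‖ ^ 2) ^ 3)⁻¹ * Real.exp (-‖v‖ ^ 2 / R) * ‖v‖ * 1 * (C * (1 + ‖v‖ ^ 2)) := by
          gcongr
          · exact hv0 v
          · exact k2r_ref_tk_abs_sinCoord_le 0 x
          · exact hκb x v
      _ = _ := by ring
  have hg2 : Integrable (fun v : EuclideanSpace ℝ (Fin 3) =>
      C * (‖v‖ ^ 1 * (((1 + ‖v‖ ^ 2) ^ 3)⁻¹ * Real.exp (-‖v‖ ^ 2 / R)) +
        ‖v‖ ^ 3 * (((1 + ‖v‖ ^ 2) ^ 3)⁻¹ * Real.exp (-‖v‖ ^ 2 / R)))) :=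
    (hi1.fun_add hi3).const_mul C
  have hG2 : Integrable (fun p : UnitAddTorus (Fin 3) × EuclideanSpace ℝ (Fin 3) =>
      ((1 + ‖p.2‖ ^ 2) ^ 3)⁻¹ * Real.exp (-‖p.2‖ ^ 2 / R) * p.2 0 * Torus.sinCoord 0 p.1 * κ p.1 p.2)
      (volume.prod volume) :=
    k2r_ref_tk_integrable_prod (by fun_prop (disch := intros; positivity)) hg2 hG2b
  -- the full integrand is a combination of the two pieces
  have hFeq : (fun p : UnitAddTorus (Fin 3) × EuclideanSpace ℝ (Fin 3) => ((1 + ‖p.2‖ ^ 2) ^ 3)⁻¹ * Real.exp (-‖p.2‖ ^ 2 / R) * ((-(z' * Torus.cosCoord 0 p.1 + z * (p.2 0 * (-(2 * Real.pi) * Torus.sinCoord 0 p.1)))) * (lam⁻¹ * κ p.1 p.2))) =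
      fun p => -(z' * lam⁻¹) * (((1 + ‖p.2‖ ^ 2) ^ 3)⁻¹ * Real.exp (-‖p.2‖ ^ 2 / R) * Torus.cosCoord 0 p.1 * κ p.1 p.2) +
        z * (2 * Real.pi / lam) * (((1 + ‖p.2‖ ^ 2) ^ 3)⁻¹ * Real.exp (-‖p.2‖ ^ 2 / R) * p.2 0 * Torus.sinCoord 0 p.1 * κ p.1 p.2) := by
    funext p
    ring
  have hF : Integrable (fun p : UnitAddTorus (Fin 3) × EuclideanSpace ℝ (Fin 3) => ((1 + ‖p.2‖ ^ 2) ^ 3)⁻¹ * Real.exp (-‖p.2‖ ^ 2 / R) * ((-(z' * Torus.cosCoord 0 p.1 + z * (p.2 0 * (-(2 * Real.pi) * Torus.sinCoord 0 p.1)))) * (lam⁻¹ * κ p.1 p.2))) (volume.prod volume) := by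
    rw [hFeq]
    exact (hG1.const_mul _).fun_add (hG2.const_mul _)
  refine ⟨hF, ?_⟩
  -- pass to product integrals
  have e1 : (∫ x : UnitAddTorus (Fin 3), ∫ v : EuclideanSpace ℝ (Fin 3), ((1 + ‖v‖ ^ 2) ^ 3)⁻¹ * Real.exp (-‖v‖ ^ 2 / R) * ((-(z' * Torus.cosCoord 0 x + z * (v 0 * (-(2 * Real.pi) * Torus.sinCoord 0 x)))) * (lam⁻¹ * κ x v))) =
      ∫ p, ((1 + ‖p.2‖ ^ 2) ^ 3)⁻¹ * Real.exp (-‖p.2‖ ^ 2 / R) * ((-(z' * Torus.cosCoord 0 p.1 + z * (p.2 0 * (-(2 * Real.pi) * Torus.sinCoord 0 p.1)))) * (lam⁻¹ * κ p.1 p.2)) ∂((volume : Measure (UnitAddTorus (Fin 3))).prod (volume : Measure (EuclideanSpace ℝ (Fin 3)))) :=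
    (integral_prod _ hF).symm
  have e2 : (∫ x : UnitAddTorus (Fin 3), ∫ v : EuclideanSpace ℝ (Fin 3), ((1 + ‖v‖ ^ 2) ^ 3)⁻¹ * Real.exp (-‖v‖ ^ 2 / R) * v 0 * Torus.sinCoord 0 x * κ x v) =
      ∫ p, ((1 + ‖p.2‖ ^ 2) ^ 3)⁻¹ * Real.exp (-‖p.2‖ ^ 2 / R) * p.2 0 * Torus.sinCoord 0 p.1 * κ p.1 p.2 ∂((volume : Measure (UnitAddTorus (Fin 3))).prod (volume : Measure (EuclideanSpace ℝ (Fin 3)))) :=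
    (integral_prod _ hG2).symm
  have e3 : (∫ p, ((1 + ‖p.2‖ ^ 2) ^ 3)⁻¹ * Real.exp (-‖p.2‖ ^ 2 / R) * ((-(z' * Torus.cosCoord 0 p.1 + z * (p.2 0 * (-(2 * Real.pi) * Torus.sinCoord 0 p.1)))) * (lam⁻¹ * κ p.1 p.2)) ∂((volume : Measure (UnitAddTorus (Fin 3))).prod (volume : Measure (EuclideanSpace ℝ (Fin 3))))) =
      -(z' * lam⁻¹) * (∫ p, ((1 + ‖p.2‖ ^ 2) ^ 3)⁻¹ * Real.exp (-‖p.2‖ ^ 2 / R) * Torus.cosCoord 0 p.1 * κ p.1 p.2 ∂((volume : Measure (UnitAddTorus (Fin 3))).prod (volume : Measure (EuclideanSpace ℝ (Fin 3))))) +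
        z * (2 * Real.pi / lam) * (∫ p, ((1 + ‖p.2‖ ^ 2) ^ 3)⁻¹ * Real.exp (-‖p.2‖ ^ 2 / R) * p.2 0 * Torus.sinCoord 0 p.1 * κ p.1 p.2 ∂((volume : Measure (UnitAddTorus (Fin 3))).prod (volume : Measure (EuclideanSpace ℝ (Fin 3))))) := by
    rw [hFeq, integral_add (hG1.const_mul _) (hG2.const_mul _), integral_const_mul, integral_const_mul]
  -- the bounded piece
  have hI1 : |∫ p, ((1 + ‖p.2‖ ^ 2) ^ 3)⁻¹ * Real.exp (-‖p.2‖ ^ 2 / R) * Torus.cosCoord 0 p.1 * κ p.1 p.2 ∂((volume : Measure (UnitAddTorus (Fin 3))).prod (volume : Measure (EuclideanSpace ℝ (Fin 3))))| ≤ C * 40 := by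
    refine (k2r_ref_tk_abs_integral_prod_le hg1 hG1b).trans ?_
    rw [integral_const_mul, integral_add hi0 hi2]
    have : 0 ≤ C * (40 - ((∫ v : EuclideanSpace ℝ (Fin 3), ‖v‖ ^ 0 * (((1 + ‖v‖ ^ 2) ^ 3)⁻¹ * Real.exp (-‖v‖ ^ 2 / R))) +
        ∫ v : EuclideanSpace ℝ (Fin 3), ‖v‖ ^ 2 * (((1 + ‖v‖ ^ 2) ^ 3)⁻¹ * Real.exp (-‖v‖ ^ 2 / R)))) :=
      mul_nonneg hC (by linarith)
    linarith
  rw [e1, e2, e3, add_sub_cancel_right, abs_mul, abs_neg, abs_mul, abs_of_pos (inv_pos.2 hlam)]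
  have hz : 0 ≤ |z| * (40 * C / lam) := by positivity
  calc |z'| * lam⁻¹ * |∫ p, ((1 + ‖p.2‖ ^ 2) ^ 3)⁻¹ * Real.exp (-‖p.2‖ ^ 2 / R) * Torus.cosCoord 0 p.1 * κ p.1 p.2 ∂((volume : Measure (UnitAddTorus (Fin 3))).prod (volume : Measure (EuclideanSpace ℝ (Fin 3))))|
      ≤ |z'| * lam⁻¹ * (C * 40) := by gcongr
    _ = |z'| * (40 * C / lam) := by ring
    _ ≤ (|z| + |z'|) * (40 * C / lam) := by rw [add_mul]; linarith

end Summit.AtomisticToContinuum.HydrodynamicLimit.Theorems.EnskogAdjointDuality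

end
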